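import Summits.CriticalPhenomena.CardyFormulaZ2.Theorems.CardyWhiteToColouredSimilarityUpgradeStubRectangleDualityPart1

/-!
# Rectangle duality for bond-ℤ² crossing limits, part 2: the discrete arcs lie on the rim sides

Support file for stub `stub_rectangleDuality` (stub D) of line `registered` of crux
`SimilarityUpgrade` (stmt-CriticalPhenomena-4597, route `CardyWhiteToColoured`, sub-problem
`CardyFormulaZ2`): for full bond-ℤ² crossing limits `Φ`, `Φ (Q w₀) + Φ (Q' w₀) = 1` for the
left–right and bottom–top marked boxes `(0, w₀) × (0, 1)`.

Continuing part 1 (the box `Ioo 0 w ×ℂ Ioo 0 1` at a mesh `δ` with `δ (b + 2) = 1`,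
`δ (a + 1) < w ≤ δ (a + 2)`): discrete boundary vertices lie on the rim of the lattice box
(`rim_of_mem_meshBoundary`), and the discrete arc (`discreteArc`, Smirnov 2001 §2: boundary
vertices of `Ω_δ` at least as close to the arc as to the rest of `∂Ω`) of the LEFT side
`{re = 0}` is contained in the first column `{v 0 = 1}` (`arc_left_subset`), of the RIGHT side
`{re = w}` in the last column `{v 0 = a + 1}` (`arc_right_subset`), of the BOTTOM side
`{im = 0}` in the first row (`arc_bottom_subset`), of the TOP side `{im = 1}` in the last row
(`arc_top_subset`): a rim vertex off the side in question is within `δ` of another side but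
farther than `δ` from that side.

Adapted from `Theorems/CardyBoundaryCoulombGasHalfPlaneMarkDensityLawBoxExhaustionPart2.lean`.
No definitions are introduced.
-/

noncomputable section

namespace Summit.CriticalPhenomena.CardyFormulaZ2.Cruxes.SimilarityUpgrade.Stubs

open Set Metric Complex MeasureTheory Filter Topology
open Literature.Probability.LatticeModels Literature.Probability.Percolation
open Literature.Probability.RandomPlanarGeometry (ConformalRectangle)

variable {w δ : ℝ}

namespace RectangleDuality

/-! ## The rim: discrete boundary vertices of the box -/

/-- **Discrete boundary vertices of the box lie on the rim** of the lattice box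
`[1, a + 1] × [1, b + 1]`. [folklore] -/
theorem rim_of_mem_meshBoundary (hδ : 0 < δ) {a b : ℕ} (ha : δ * (a + 1) < w)
    (ha' : w ≤ δ * (a + 2)) (hb : δ * (b + 2) = 1) {v : Site 2}
    (hv : v ∈ meshBoundary (Ioo (0 : ℝ) w ×ℂ Ioo (0 : ℝ) 1) δ) :
    ((1 ≤ v 0 ∧ v 0 ≤ a + 1) ∧ (1 ≤ v 1 ∧ v 1 ≤ b + 1)) ∧
      (v 0 = 1 ∨ v 0 = a + 1 ∨ v 1 = 1 ∨ v 1 = b + 1) := by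
  rw [mem_meshBoundary_iff', meshDomain_box hδ] at hv
  obtain ⟨hvV, y, hvy, hy⟩ := hv
  have hyV : y ∉ meshVertices (Ioo (0 : ℝ) w ×ℂ Ioo (0 : ℝ) 1) δ := by
    intro hyV
    rcases hy with hy | hy
    · exact hy hyV
    · exact hy (meshGraph_adj_box hvV hyV hvy)
  rw [mem_meshVertices_box_iff hδ ha ha' hb] at hvV hyV
  refine ⟨hvV, ?_⟩
  -- coordinates of the lattice neighbour `y` of `v`
  have hco : (y 0 = v 0 + 1 ∧ y 1 = v 1) ∨ (y 0 = v 0 - 1 ∧ y 1 = v 1) ∨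
      (y 0 = v 0 ∧ y 1 = v 1 + 1) ∨ (y 0 = v 0 ∧ y 1 = v 1 - 1) := by
    obtain ⟨i, hi | hi⟩ := (zdGraph_adj_iff v y).1 hvy
    · have h0 := congr_fun hi 0
      have h1 := congr_fun hi 1
      fin_cases i
      · left; simp at h0 h1; omega
      · right; right; left; simp at h0 h1; omega
    · have h0 := congr_fun hi 0
      have h1 := congr_fun hi 1
      fin_cases i
      · right; left; simp at h0 h1; omega
      · right; right; right; simp at h0 h1; omega
  rcases hco with ⟨h0, h1⟩ | ⟨h0, h1⟩ | ⟨h0, h1⟩ | ⟨h0, h1⟩ <;> omega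

/-! ## Discrete arcs of the four sides: the arcs lie on the corresponding rim sides -/

/-- **The discrete arc of the LEFT side lies in the first column.** [folklore] -/
theorem arc_left_subset (hδ : 0 < δ) {a b : ℕ} (ha : δ * (a + 1) < w) (ha' : w ≤ δ * (a + 2))
    (hb : δ * (b + 2) = 1) {v : Site 2}
    (hv : v ∈ discreteArc (Ioo (0 : ℝ) w ×ℂ Ioo (0 : ℝ) 1) δ {z : ℂ | z.re = 0 ∧ z.im ∈ Icc (0 : ℝ) 1}) :
    v 0 = 1 := by
  obtain ⟨hvb, hdist⟩ := hv
  have hvV : v ∈ meshVertices (Ioo (0 : ℝ) w ×ℂ Ioo (0 : ℝ) 1) δ := by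
    rw [← meshDomain_box hδ]; exact meshBoundary_subset_meshDomain _ _ hvb
  obtain ⟨hw, ⟨e0, e1⟩, ⟨e2, e3⟩, -, -⟩ := coords_of_mem hδ ha ha' hb hvV
  obtain ⟨-, hrim⟩ := rim_of_mem_meshBoundary hδ ha ha' hb hvb
  rw [show meshPoint δ v = ⟨δ * v 0, δ * v 1⟩ from Complex.ext (meshPoint_re δ v) (meshPoint_im δ v)] at hdist
  by_contra hne
  have h2 : (2 : ℝ) ≤ v 0 := by
    have := (one_le_of_mem hδ hvV).1
    exact_mod_cast (show (2 : ℤ) ≤ v 0 by omega)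
  have hA : ({z : ℂ | z.re = 0 ∧ z.im ∈ Icc (0 : ℝ) 1} : Set ℂ).Nonempty := ⟨0, by simp⟩
  have hL : 2 * δ ≤ infDist (⟨δ * v 0, δ * v 1⟩ : ℂ) {z : ℂ | z.re = 0 ∧ z.im ∈ Icc (0 : ℝ) 1} := by
    rw [le_infDist hA]
    rintro q ⟨hq0, -⟩
    refine le_trans ?_ (abs_re_sub_le_dist _ q)
    rw [hq0, sub_zero]
    refine le_trans ?_ (le_abs_self _)
    simpa [mul_comm] using mul_le_mul_of_nonneg_left h2 hδ.le
  have hU : infDist (⟨δ * v 0, δ * v 1⟩ : ℂ)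
      (frontier (Ioo (0 : ℝ) w ×ℂ Ioo (0 : ℝ) 1) \ {z : ℂ | z.re = 0 ∧ z.im ∈ Icc (0 : ℝ) 1}) ≤ δ := by
    rcases hrim with h | h | h | h
    · exact absurd h hne
    · obtain ⟨hf, hd⟩ := foot_right hδ ha ha' hb hvV h
      refine le_trans (infDist_le_dist_of_mem ?_) hd
      refine ⟨hf, ?_⟩
      rintro ⟨h0, -⟩; exact hw.ne' h0
    · obtain ⟨hf, hd⟩ := foot_bottom hδ ha ha' hb hvV h
      refine le_trans (infDist_le_dist_of_mem ?_) hd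
      refine ⟨hf, ?_⟩
      rintro ⟨h0, -⟩; simp only at h0; linarith
    · obtain ⟨hf, hd⟩ := foot_top hδ ha ha' hb hvV h
      refine le_trans (infDist_le_dist_of_mem ?_) hd
      refine ⟨hf, ?_⟩
      rintro ⟨h0, -⟩; simp only at h0; linarith
  linarith [hL.trans (hdist.trans hU)]

/-- **The discrete arc of the RIGHT side lies in the last column.** [folklore] -/
theorem arc_right_subset (hδ : 0 < δ) {a b : ℕ} (ha : δ * (a + 1) < w) (ha' : w ≤ δ * (a + 2))
    (hb : δ * (b + 2) = 1) {v : Site 2}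
    (hv : v ∈ discreteArc (Ioo (0 : ℝ) w ×ℂ Ioo (0 : ℝ) 1) δ {z : ℂ | z.re = w ∧ z.im ∈ Icc (0 : ℝ) 1}) :
    v 0 = a + 1 := by
  obtain ⟨hvb, hdist⟩ := hv
  have hvV : v ∈ meshVertices (Ioo (0 : ℝ) w ×ℂ Ioo (0 : ℝ) 1) δ := by
    rw [← meshDomain_box hδ]; exact meshBoundary_subset_meshDomain _ _ hvb
  obtain ⟨hw, ⟨e0, e1⟩, ⟨e2, e3⟩, -, -⟩ := coords_of_mem hδ ha ha' hb hvV
  obtain ⟨⟨⟨h01, h0a⟩, -⟩, hrim⟩ := rim_of_mem_meshBoundary hδ ha ha' hb hvb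
  rw [show meshPoint δ v = ⟨δ * v 0, δ * v 1⟩ from Complex.ext (meshPoint_re δ v) (meshPoint_im δ v)] at hdist
  by_contra hne
  have h2 : (v 0 : ℝ) ≤ a := by exact_mod_cast (show v 0 ≤ (a : ℤ) by omega)
  have h2' : δ * v 0 ≤ δ * a := mul_le_mul_of_nonneg_left h2 hδ.le
  have hA : ({z : ℂ | z.re = w ∧ z.im ∈ Icc (0 : ℝ) 1} : Set ℂ).Nonempty := ⟨⟨w, 0⟩, rfl, by simp⟩
  have hL : w - δ * a ≤ infDist (⟨δ * v 0, δ * v 1⟩ : ℂ) {z : ℂ | z.re = w ∧ z.im ∈ Icc (0 : ℝ) 1} := by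
    rw [le_infDist hA]
    rintro q ⟨hq0, -⟩
    refine le_trans ?_ (abs_re_sub_le_dist _ q)
    rw [hq0, abs_sub_comm]
    refine le_trans ?_ (le_abs_self _)
    change w - δ * a ≤ w - δ * v 0
    linarith
  have hU : infDist (⟨δ * v 0, δ * v 1⟩ : ℂ)
      (frontier (Ioo (0 : ℝ) w ×ℂ Ioo (0 : ℝ) 1) \ {z : ℂ | z.re = w ∧ z.im ∈ Icc (0 : ℝ) 1}) ≤ δ := by
    rcases hrim with h | h | h | h
    · obtain ⟨hf, hd⟩ := foot_left hδ ha ha' hb hvV h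
      refine le_trans (infDist_le_dist_of_mem ?_) hd
      refine ⟨hf, ?_⟩
      rintro ⟨h0, -⟩; exact hw.ne h0
    · exact absurd h hne
    · obtain ⟨hf, hd⟩ := foot_bottom hδ ha ha' hb hvV h
      refine le_trans (infDist_le_dist_of_mem ?_) hd
      refine ⟨hf, ?_⟩
      rintro ⟨h0, -⟩; simp only at h0; linarith
    · obtain ⟨hf, hd⟩ := foot_top hδ ha ha' hb hvV h
      refine le_trans (infDist_le_dist_of_mem ?_) hd
      refine ⟨hf, ?_⟩
      rintro ⟨h0, -⟩; simp only at h0; linarith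
  linarith [hL.trans (hdist.trans hU)]

/-- **The discrete arc of the BOTTOM side lies in the first row.** [folklore] -/
theorem arc_bottom_subset (hδ : 0 < δ) {a b : ℕ} (ha : δ * (a + 1) < w) (ha' : w ≤ δ * (a + 2))
    (hb : δ * (b + 2) = 1) {v : Site 2}
    (hv : v ∈ discreteArc (Ioo (0 : ℝ) w ×ℂ Ioo (0 : ℝ) 1) δ {z : ℂ | z.im = 0 ∧ z.re ∈ Icc (0 : ℝ) w}) :
    v 1 = 1 := by
  obtain ⟨hvb, hdist⟩ := hv
  have hvV : v ∈ meshVertices (Ioo (0 : ℝ) w ×ℂ Ioo (0 : ℝ) 1) δ := by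
    rw [← meshDomain_box hδ]; exact meshBoundary_subset_meshDomain _ _ hvb
  obtain ⟨hw, ⟨e0, e1⟩, ⟨e2, e3⟩, -, -⟩ := coords_of_mem hδ ha ha' hb hvV
  obtain ⟨-, hrim⟩ := rim_of_mem_meshBoundary hδ ha ha' hb hvb
  rw [show meshPoint δ v = ⟨δ * v 0, δ * v 1⟩ from Complex.ext (meshPoint_re δ v) (meshPoint_im δ v)] at hdist
  by_contra hne
  have h2 : (2 : ℝ) ≤ v 1 := by
    have := (one_le_of_mem hδ hvV).2
    exact_mod_cast (show (2 : ℤ) ≤ v 1 by omega)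
  have hA : ({z : ℂ | z.im = 0 ∧ z.re ∈ Icc (0 : ℝ) w} : Set ℂ).Nonempty := ⟨0, by simp [hw.le]⟩
  have hL : 2 * δ ≤ infDist (⟨δ * v 0, δ * v 1⟩ : ℂ) {z : ℂ | z.im = 0 ∧ z.re ∈ Icc (0 : ℝ) w} := by
    rw [le_infDist hA]
    rintro q ⟨hq0, -⟩
    have him : |(⟨δ * v 0, δ * v 1⟩ : ℂ).im - q.im| ≤ dist (⟨δ * v 0, δ * v 1⟩ : ℂ) q := by
      rw [dist_eq_norm, ← sub_im]; exact abs_im_le_norm _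
    refine le_trans ?_ him
    rw [hq0, sub_zero]
    refine le_trans ?_ (le_abs_self _)
    simpa [mul_comm] using mul_le_mul_of_nonneg_left h2 hδ.le
  have hU : infDist (⟨δ * v 0, δ * v 1⟩ : ℂ)
      (frontier (Ioo (0 : ℝ) w ×ℂ Ioo (0 : ℝ) 1) \ {z : ℂ | z.im = 0 ∧ z.re ∈ Icc (0 : ℝ) w}) ≤ δ := by
    rcases hrim with h | h | h | h
    · obtain ⟨hf, hd⟩ := foot_left hδ ha ha' hb hvV h
      refine le_trans (infDist_le_dist_of_mem ?_) hd
      refine ⟨hf, ?_⟩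
      rintro ⟨h0, -⟩; simp only at h0; linarith
    · obtain ⟨hf, hd⟩ := foot_right hδ ha ha' hb hvV h
      refine le_trans (infDist_le_dist_of_mem ?_) hd
      refine ⟨hf, ?_⟩
      rintro ⟨h0, -⟩; simp only at h0; linarith
    · exact absurd h hne
    · obtain ⟨hf, hd⟩ := foot_top hδ ha ha' hb hvV h
      refine le_trans (infDist_le_dist_of_mem ?_) hd
      refine ⟨hf, ?_⟩
      rintro ⟨h0, -⟩; simp only at h0; linarith
  linarith [hL.trans (hdist.trans hU)]

/-- **The discrete arc of the TOP side lies in the last row.** [folklore] -/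
theorem arc_top_subset (hδ : 0 < δ) {a b : ℕ} (ha : δ * (a + 1) < w) (ha' : w ≤ δ * (a + 2))
    (hb : δ * (b + 2) = 1) {v : Site 2}
    (hv : v ∈ discreteArc (Ioo (0 : ℝ) w ×ℂ Ioo (0 : ℝ) 1) δ {z : ℂ | z.im = 1 ∧ z.re ∈ Icc (0 : ℝ) w}) :
    v 1 = b + 1 := by
  obtain ⟨hvb, hdist⟩ := hv
  have hvV : v ∈ meshVertices (Ioo (0 : ℝ) w ×ℂ Ioo (0 : ℝ) 1) δ := by
    rw [← meshDomain_box hδ]; exact meshBoundary_subset_meshDomain _ _ hvb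
  obtain ⟨hw, ⟨e0, e1⟩, ⟨e2, e3⟩, -, -⟩ := coords_of_mem hδ ha ha' hb hvV
  obtain ⟨⟨-, h11, h1b⟩, hrim⟩ := rim_of_mem_meshBoundary hδ ha ha' hb hvb
  rw [show meshPoint δ v = ⟨δ * v 0, δ * v 1⟩ from Complex.ext (meshPoint_re δ v) (meshPoint_im δ v)] at hdist
  by_contra hne
  have h2 : (v 1 : ℝ) ≤ b := by exact_mod_cast (show v 1 ≤ (b : ℤ) by omega)
  have h2' : δ * v 1 ≤ δ * b := mul_le_mul_of_nonneg_left h2 hδ.le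
  have hA : ({z : ℂ | z.im = 1 ∧ z.re ∈ Icc (0 : ℝ) w} : Set ℂ).Nonempty :=
    ⟨⟨0, 1⟩, rfl, by simp [hw.le]⟩
  have hL : 1 - δ * b ≤ infDist (⟨δ * v 0, δ * v 1⟩ : ℂ) {z : ℂ | z.im = 1 ∧ z.re ∈ Icc (0 : ℝ) w} := by
    rw [le_infDist hA]
    rintro q ⟨hq0, -⟩
    have him : |(⟨δ * v 0, δ * v 1⟩ : ℂ).im - q.im| ≤ dist (⟨δ * v 0, δ * v 1⟩ : ℂ) q := by
      rw [dist_eq_norm, ← sub_im]; exact abs_im_le_norm _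
    refine le_trans ?_ him
    rw [hq0, abs_sub_comm]
    refine le_trans ?_ (le_abs_self _)
    change 1 - δ * b ≤ 1 - δ * v 1
    linarith
  have hU : infDist (⟨δ * v 0, δ * v 1⟩ : ℂ)
      (frontier (Ioo (0 : ℝ) w ×ℂ Ioo (0 : ℝ) 1) \ {z : ℂ | z.im = 1 ∧ z.re ∈ Icc (0 : ℝ) w}) ≤ δ := by
    rcases hrim with h | h | h | h
    · obtain ⟨hf, hd⟩ := foot_left hδ ha ha' hb hvV h
      refine le_trans (infDist_le_dist_of_mem ?_) hd
      refine ⟨hf, ?_⟩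
      rintro ⟨h0, -⟩; simp only at h0; linarith
    · obtain ⟨hf, hd⟩ := foot_right hδ ha ha' hb hvV h
      refine le_trans (infDist_le_dist_of_mem ?_) hd
      refine ⟨hf, ?_⟩
      rintro ⟨h0, -⟩; simp only at h0; linarith
    · obtain ⟨hf, hd⟩ := foot_bottom hδ ha ha' hb hvV h
      refine le_trans (infDist_le_dist_of_mem ?_) hd
      refine ⟨hf, ?_⟩
      rintro ⟨h0, -⟩; simp only at h0; linarith
    · exact absurd h hne
  linarith [hL.trans (hdist.trans hU)]

end RectangleDuality

/-- Registered stub of this support file (part 2 of the rectangle duality): the discrete arc of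
the left side lies in the first column. [folklore] -/
theorem stub_rectangleDuality_arcLeft :
    ∀ (w δ : ℝ) (a b : ℕ), 0 < δ → δ * (a + 1) < w → w ≤ δ * (a + 2) → δ * (b + 2) = 1 →
      ∀ v : Site 2, v ∈ discreteArc (Ioo (0 : ℝ) w ×ℂ Ioo (0 : ℝ) 1) δ
        {z : ℂ | z.re = 0 ∧ z.im ∈ Icc (0 : ℝ) 1} → v 0 = 1 :=
  fun _ _ _ _ hδ ha ha' hb _ hv => RectangleDuality.arc_left_subset hδ ha ha' hb hv

end Summit.CriticalPhenomena.CardyFormulaZ2.Cruxes.SimilarityUpgrade.Stubs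

end
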